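import Mathlib
import HarnessLib

/-!
# Algebraic cores of Theorem Q (quadratic Lyapunov functionals of Navier–Stokes) and Proposition V

Soloist (blind) report `sharpest.md` v14 §2.6.

*Theorem Q0/Q.* A Fourier-multiplier quadratic form `F_M[u] = ∫ û(k)* M(k) û(k) dk` is conserved by 3D Euler
for all Schwartz divergence-free data iff `P M P = α P + β i[k]ₓ` (energy and helicity), and is non-increasing
along 3D Navier–Stokes for all such data iff `P M P = α P`, `α ≥ 0`.  The proof reduces to single triads
`k₁ + k₂ + k₃ = 0`; on a triad the six-mode Euler system is the 2D Euler triad for the in-plane stream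
amplitudes `ψⱼ` plus passive advection of the out-of-plane velocity `θⱼ`, and conservation of a leg-form
`Σⱼ aⱼ|ψⱼ|² + cⱼ|θⱼ|² + 2 Re(ζⱼ ψ̄ⱼ θⱼ)`, `ζⱼ = yⱼ + i zⱼ`, is the linear system (with `Kⱼ = |kⱼ|²`,
`Dⱼ = (K_{j+2} - K_{j+1})/Kⱼ`):
`Σ aⱼ Dⱼ = 0`, `c₁ = c₂ = c₃`, `yⱼDⱼ + y_{j+1} - y_{j+2} = 0`, `zⱼDⱼ - z_{j+1} + z_{j+2} = 0`.
This file certifies the finite-dimensional algebra of that step and of the dissipation step: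
* `triad_det_eq_zero` — both 3×3 systems are singular: `D₁D₂D₃ + D₁ + D₂ + D₃ = 0`;
* `triad_ySystem_kernel`, `triad_ySystem_unique` — the y-system's solution space is exactly `ℝ·(K₁,K₂,K₃)` (helicity);
* `triad_zSystem_kernel`, `triad_zSystem_parallel` — the z-system's solutions are parallel to
  `wⱼ = Kⱼ(Kⱼ - K_{j+1} - K_{j+2})` (the triad-specific fifth invariant), which is never zero;
* `triad_aEquation_energy_enstrophy` — `aⱼ = α Kⱼ + b Kⱼ²` solves the a-equation (in-plane energy and enstrophy);
* `dissipation_weights_nonneg_iff` — `(∀ t > 0, 0 ≤ a + b t ∧ 0 ≤ a - b t) ↔ b = 0 ∧ 0 ≤ a` (Step D on ℝ³: only the energy survives);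
* `dissipation_weights_trunc_iff` — on a Galerkin truncation `t ≤ K` the same condition is the Kraichnan cone `|b| K ≤ a`;
* `weights_affine_nonneg_iff` — the 2D control: `(∀ K > 0, 0 ≤ α + γ K) ↔ 0 ≤ α ∧ 0 ≤ γ` (energy and enstrophy both survive).
*Proposition V* (no positively homogeneous function of the vorticity obeys a maximum principle in 3D) uses the Gaussian
vortex blob `u = ½ e^{-|x|²} (e₃ × x)` whose vorticity is `e^{-|x|²}((1-|x|²)e₃ + x₃ x)`;
* `vortexBlob_vorticity_normSq` — `|ω|² e^{2|x|²} = (1-|x|²)² + x₃²(2-|x|²)`;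
* `vortexBlob_normSq_lt_one` — this is `< e^{2|x|²}` away from the origin, i.e. `|ω(x)| < |ω(0)| = 1` for `x ≠ 0`.
The cited equations themselves (Step A localisation, the `(ψ, θ)` normal form, Danskin) are proved in the report, not here.

The linter option `linter.dupNamespace` is disabled because the mandated landing namespace repeats the summit name by
design (D-0017). [problem: ns]
-/

set_option linter.dupNamespace false

namespace Summit.NavierStokesRegularity.NavierStokesRegularity.Theorems

/-! ### The per-triad linear algebra (Step B) -/

/-- Both 3×3 systems of Step B are singular: with `Dⱼ = (K_{j+2} - K_{j+1})/Kⱼ`,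
`D₁ D₂ D₃ + D₁ + D₂ + D₃ = 0`. -/
theorem triad_det_eq_zero (K₁ K₂ K₃ : ℝ) (h₁ : K₁ ≠ 0) (h₂ : K₂ ≠ 0) (h₃ : K₃ ≠ 0) :
    (K₃ - K₂) / K₁ * ((K₁ - K₃) / K₂) * ((K₂ - K₁) / K₃)
      + (K₃ - K₂) / K₁ + (K₁ - K₃) / K₂ + (K₂ - K₁) / K₃ = 0 := by
  field_simp
  ring

/-- Helicity: `yⱼ = d Kⱼ` solves the y-system `yⱼ Dⱼ + y_{j+1} - y_{j+2} = 0` (indices mod 3). -/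
theorem triad_ySystem_kernel (K₁ K₂ K₃ d : ℝ) (h₁ : K₁ ≠ 0) (h₂ : K₂ ≠ 0) (h₃ : K₃ ≠ 0) :
    d * K₁ * ((K₃ - K₂) / K₁) + d * K₂ - d * K₃ = 0 ∧
    d * K₂ * ((K₁ - K₃) / K₂) + d * K₃ - d * K₁ = 0 ∧
    d * K₃ * ((K₂ - K₁) / K₃) + d * K₁ - d * K₂ = 0 := by
  refine ⟨?_, ?_, ?_⟩ <;> field_simp <;> ring

/-- The y-system has a one-dimensional solution space for every triple of non-zero `Kⱼ`:
every solution is `d • (K₁, K₂, K₃)`.  (Stated with denominators cleared: equation `j` multiplied by `Kⱼ`.) -/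
theorem triad_ySystem_unique (K₁ K₂ K₃ y₁ y₂ y₃ : ℝ) (h₁ : K₁ ≠ 0)
    (E₁ : y₁ * (K₃ - K₂) + (y₂ - y₃) * K₁ = 0)
    (E₂ : y₂ * (K₁ - K₃) + (y₃ - y₁) * K₂ = 0)
    (E₃ : y₃ * (K₂ - K₁) + (y₁ - y₂) * K₃ = 0) :
    ∃ d : ℝ, y₁ = d * K₁ ∧ y₂ = d * K₂ ∧ y₃ = d * K₃ := by
  -- two eliminations, each producing (linear factor) * (y₂ K₁ - y₁ K₂) = 0; the factors cannot both vanish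
  have c₁ : (K₁ + K₂ - K₃) * (y₂ * K₁ - y₁ * K₂) = 0 := by linear_combination K₂ * E₁ + K₁ * E₂
  have c₂ : (K₁ + K₃ - K₂) * (y₁ * K₂ - y₂ * K₁) = 0 := by linear_combination (K₂ - K₁) * E₁ + K₁ * E₃
  have P : y₂ * K₁ - y₁ * K₂ = 0 := by
    rcases mul_eq_zero.mp c₁ with h | h
    · rcases mul_eq_zero.mp c₂ with h' | h'
      · exfalso; apply h₁; linarith
      · linarith
    · exact h
  refine ⟨y₁ / K₁, ?_, ?_, ?_⟩
  · field_simp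
  · field_simp; linarith
  · -- from E₁: y₃ K₁ = y₁ (K₃ - K₂) + y₂ K₁
    field_simp
    nlinarith [P, E₁]

/-- The fifth (triad-specific) invariant: `zⱼ = e Kⱼ (Kⱼ - K_{j+1} - K_{j+2})` ( `= 2 e Kⱼ (k_{j+1}·k_{j+2})` )
solves the z-system `zⱼ Dⱼ - z_{j+1} + z_{j+2} = 0`. -/
theorem triad_zSystem_kernel (K₁ K₂ K₃ e : ℝ) (h₁ : K₁ ≠ 0) (h₂ : K₂ ≠ 0) (h₃ : K₃ ≠ 0) :
    e * K₁ * (K₁ - K₂ - K₃) * ((K₃ - K₂) / K₁) - e * K₂ * (K₂ - K₃ - K₁) + e * K₃ * (K₃ - K₁ - K₂) = 0 ∧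
    e * K₂ * (K₂ - K₃ - K₁) * ((K₁ - K₃) / K₂) - e * K₃ * (K₃ - K₁ - K₂) + e * K₁ * (K₁ - K₂ - K₃) = 0 ∧
    e * K₃ * (K₃ - K₁ - K₂) * ((K₂ - K₁) / K₃) - e * K₁ * (K₁ - K₂ - K₃) + e * K₂ * (K₂ - K₃ - K₁) = 0 := by
  refine ⟨?_, ?_, ?_⟩ <;> field_simp <;> ring

/-- Uniqueness for the z-system (denominators cleared): every solution is parallel to
`w = (K₁(K₁-K₂-K₃), K₂(K₂-K₃-K₁), K₃(K₃-K₁-K₂))`, i.e. `z × w = 0`; and `w ≠ 0` when the `Kⱼ` are non-zero. -/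
theorem triad_zSystem_parallel (K₁ K₂ K₃ z₁ z₂ z₃ : ℝ)
    (Z₁ : z₁ * (K₃ - K₂) + (z₃ - z₂) * K₁ = 0)
    (Z₂ : z₂ * (K₁ - K₃) + (z₁ - z₃) * K₂ = 0)
    (Z₃ : z₃ * (K₂ - K₁) + (z₂ - z₁) * K₃ = 0) :
    z₁ * (K₂ * (K₂ - K₃ - K₁)) = z₂ * (K₁ * (K₁ - K₂ - K₃)) ∧
    z₂ * (K₃ * (K₃ - K₁ - K₂)) = z₃ * (K₂ * (K₂ - K₃ - K₁)) ∧
    z₃ * (K₁ * (K₁ - K₂ - K₃)) = z₁ * (K₃ * (K₃ - K₁ - K₂)) := by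
  refine ⟨?_, ?_, ?_⟩
  · linear_combination (-K₂) * Z₁ + (-K₁) * Z₂
  · linear_combination (-K₃) * Z₂ + (-K₂) * Z₃
  · linear_combination (-K₁) * Z₃ + (-K₃) * Z₁

/-- The vector `w` of `triad_zSystem_parallel` does not vanish when the `Kⱼ` are non-zero, so the
z-system's solution space is exactly the line `ℝ·w`. -/
theorem triad_zSystem_w_ne_zero (K₁ K₂ K₃ : ℝ) (h₁ : K₁ ≠ 0) (h₂ : K₂ ≠ 0) (h₃ : K₃ ≠ 0) :
    ¬ (K₁ * (K₁ - K₂ - K₃) = 0 ∧ K₂ * (K₂ - K₃ - K₁) = 0 ∧ K₃ * (K₃ - K₁ - K₂) = 0) := by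
  rintro ⟨a, b, c⟩
  have a' : K₁ - K₂ - K₃ = 0 := by
    rcases mul_eq_zero.mp a with h | h
    · exact absurd h h₁
    · exact h
  have b' : K₂ - K₃ - K₁ = 0 := by
    rcases mul_eq_zero.mp b with h | h
    · exact absurd h h₂
    · exact h
  apply h₃; linarith

/-- In-plane energy (`aⱼ = α Kⱼ`) and enstrophy (`aⱼ = b Kⱼ²`) solve the a-equation `Σ aⱼ Dⱼ = 0`. -/
theorem triad_aEquation_energy_enstrophy (K₁ K₂ K₃ α b : ℝ) (h₁ : K₁ ≠ 0) (h₂ : K₂ ≠ 0) (h₃ : K₃ ≠ 0) :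
    (α * K₁ + b * K₁ ^ 2) * ((K₃ - K₂) / K₁) + (α * K₂ + b * K₂ ^ 2) * ((K₁ - K₃) / K₂)
      + (α * K₃ + b * K₃ ^ 2) * ((K₂ - K₁) / K₃) = 0 := by
  field_simp
  ring

/-- In 3D the a-equation together with the scalar-variance condition (`cⱼ` equal on the legs, and after
globalisation `aⱼ = σ Kⱼ` with the same `σ = cⱼ`) kills the enstrophy direction: if `α Kⱼ + b Kⱼ² = σ Kⱼ`
on two legs of different length then `b = 0`. -/
theorem triad_no_enstrophy_in_3D (K₁ K₂ α b σ : ℝ) (h₁ : K₁ ≠ 0) (h₂ : K₂ ≠ 0) (h : K₁ ≠ K₂)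
    (e₁ : α * K₁ + b * K₁ ^ 2 = σ * K₁) (e₂ : α * K₂ + b * K₂ ^ 2 = σ * K₂) : b = 0 := by
  have f₁ : α + b * K₁ = σ := by
    have := e₁; field_simp at this ⊢; nlinarith [this]
  have f₂ : α + b * K₂ = σ := by
    have := e₂; field_simp at this ⊢; nlinarith [this]
  have : b * (K₁ - K₂) = 0 := by linear_combination f₁ - f₂
  rcases mul_eq_zero.mp this with hb | hb
  · exact hb
  · exact absurd (sub_eq_zero.mp hb) h

/-! ### The dissipation step (Step D) -/

/-- Step D on `ℝ³`: the helical weights of `α E + β H` at wavenumber `|k| = t` are `α ± β t`; they are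
non-negative for all `t > 0` iff `β = 0 ≤ α`.  Only the energy survives. -/
theorem dissipation_weights_nonneg_iff (a b : ℝ) :
    (∀ t : ℝ, 0 < t → (0 ≤ a + b * t ∧ 0 ≤ a - b * t)) ↔ (b = 0 ∧ 0 ≤ a) := by
  constructor
  · intro h
    have h1 := (h 1 one_pos).1
    have hab : ∀ t : ℝ, 0 < t → |b| * t ≤ a := by
      intro t ht
      obtain ⟨p, q⟩ := h t ht
      rcases le_or_gt 0 b with hb | hb
      · rw [abs_of_nonneg hb]; linarith
      · rw [abs_of_neg hb]; linarith
    by_contra hcon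
    rcases eq_or_ne b 0 with hb | hb
    · exact hcon ⟨hb, by subst hb; simpa using h1⟩
    · have hbpos : 0 < |b| := abs_pos.mpr hb
      have ht : 0 < (|a| + 1) / |b| := by positivity
      have key := hab _ ht
      rw [mul_div_cancel₀ _ (ne_of_gt hbpos)] at key
      linarith [le_abs_self a]
  · rintro ⟨hb, ha⟩ t _
    subst hb
    simpa using ha

/-- Step D on a Galerkin truncation `|k| ≤ K`: the same weights are non-negative on `(0, K]` iff `|β| K ≤ α`
— the energy–helicity cone of Kraichnan's 1973 absolute equilibria.  As `K → ∞` it closes to the energy ray. -/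
theorem dissipation_weights_trunc_iff (a b K : ℝ) (hK : 0 < K) :
    (∀ t : ℝ, 0 < t → t ≤ K → (0 ≤ a + b * t ∧ 0 ≤ a - b * t)) ↔ |b| * K ≤ a := by
  constructor
  · intro h
    obtain ⟨p, q⟩ := h K hK le_rfl
    rcases le_or_gt 0 b with hb | hb
    · rw [abs_of_nonneg hb]; linarith
    · rw [abs_of_neg hb]; linarith
  · intro h t ht htK
    have hbt : |b| * t ≤ a := le_trans (mul_le_mul_of_nonneg_left htK (abs_nonneg b)) h
    rcases le_or_gt 0 b with hb | hb
    · rw [abs_of_nonneg hb] at hbt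
      constructor <;> nlinarith
    · rw [abs_of_neg hb] at hbt
      constructor <;> nlinarith

/-- The 2D control: the weights of `α E + γ Z` under dissipation are `K (α + γ K)`, non-negative for all
`K = |k|² > 0` iff `α ≥ 0` and `γ ≥ 0` — energy AND enstrophy survive in 2D. -/
theorem weights_affine_nonneg_iff (α γ : ℝ) :
    (∀ K : ℝ, 0 < K → 0 ≤ α + γ * K) ↔ (0 ≤ α ∧ 0 ≤ γ) := by
  constructor
  · intro h
    have hγ : 0 ≤ γ := by
      by_contra hγ'
      have hγ : γ < 0 := lt_of_not_ge hγ'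
      have hγne : γ ≠ 0 := ne_of_lt hγ
      have ht : 0 < (|α| + 1) / (-γ) := by
        apply div_pos (by positivity); linarith
      have := h _ ht
      have e : γ * ((|α| + 1) / (-γ)) = -(|α| + 1) := by
        rw [div_neg, mul_neg, mul_div_cancel₀ _ hγne]
      rw [e] at this
      linarith [le_abs_self α]
    refine ⟨?_, hγ⟩
    by_contra hα'
    have hα : α < 0 := lt_of_not_ge hα'
    rcases eq_or_lt_of_le hγ with hγ0 | hγpos
    · have := h 1 one_pos
      rw [← hγ0] at this
      linarith
    · have hγne : γ ≠ 0 := ne_of_gt hγpos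
      have ht : 0 < -α / (2 * γ) := by
        apply div_pos (by linarith); linarith
      have := h _ ht
      have e : γ * (-α / (2 * γ)) = -α / 2 := by
        rw [mul_div_assoc', mul_comm γ, mul_div_mul_right _ _ hγne]
      rw [e] at this
      linarith
  · rintro ⟨hα, hγ⟩ K hK
    positivity

/-! ### Proposition V: the Gaussian vortex blob -/

/-- The vorticity of the blob `u = ½ e^{-|x|²}(e₃ × x)` is `e^{-|x|²}((1 - |x|²) e₃ + x₃ x)`, whose squared
length times `e^{2|x|²}` is `(1-|x|²)² + x₃²(2-|x|²)`. -/
theorem vortexBlob_vorticity_normSq (x₁ x₂ x₃ : ℝ) :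
    (x₃ * x₁) ^ 2 + (x₃ * x₂) ^ 2 + ((1 - (x₁ ^ 2 + x₂ ^ 2 + x₃ ^ 2)) + x₃ * x₃) ^ 2
      = (1 - (x₁ ^ 2 + x₂ ^ 2 + x₃ ^ 2)) ^ 2 + x₃ ^ 2 * (2 - (x₁ ^ 2 + x₂ ^ 2 + x₃ ^ 2)) := by
  ring

/-- `|ω(x)|² < 1 = |ω(0)|²` for `x ≠ 0`: with `s = |x|² > 0` and `t = x₃² ∈ [0, s]`,
`e^{-2s} ((1-s)² + t(2-s)) < 1`.  Hence the origin is the strict global maximiser of every positively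
homogeneous function of `ω` maximised (on the sphere) in the direction `e₃`. -/
theorem vortexBlob_normSq_lt_one (s t : ℝ) (hs : 0 < s) (ht0 : 0 ≤ t) (hts : t ≤ s) :
    Real.exp (-2 * s) * ((1 - s) ^ 2 + t * (2 - s)) < 1 := by
  have hexp : Real.exp (-2 * s) * Real.exp (2 * s) = 1 := by
    rw [← Real.exp_add]; simp
  have hpos : 0 < Real.exp (-2 * s) := Real.exp_pos _
  rcases le_or_gt s 2 with h2 | h2
  · -- bracket ≤ (1-s)² + s(2-s) = 1, and e^{-2s} < 1
    have hB : (1 - s) ^ 2 + t * (2 - s) ≤ 1 := by nlinarith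
    have hlt : Real.exp (-2 * s) < 1 := by
      have := Real.exp_lt_exp.mpr (show -2 * s < 0 by linarith)
      simpa using this
    calc Real.exp (-2 * s) * ((1 - s) ^ 2 + t * (2 - s))
        ≤ Real.exp (-2 * s) * 1 := by exact mul_le_mul_of_nonneg_left hB hpos.le
      _ < 1 := by simpa using hlt
  · -- bracket ≤ (s-1)² < (s+1)² ≤ e^{2s}
    have hB : (1 - s) ^ 2 + t * (2 - s) ≤ (s - 1) ^ 2 := by nlinarith
    have h3 : (s - 1) ^ 2 < Real.exp (2 * s) := by
      have h4 : s + 1 ≤ Real.exp s := Real.add_one_le_exp s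
      have h5 : (s - 1) ^ 2 < (s + 1) ^ 2 := by nlinarith
      have h6 : (s + 1) ^ 2 ≤ (Real.exp s) ^ 2 := by
        gcongr
      have h7 : (Real.exp s) ^ 2 = Real.exp (2 * s) := by
        rw [sq, ← Real.exp_add]; ring_nf
      linarith [h7 ▸ h6]
    calc Real.exp (-2 * s) * ((1 - s) ^ 2 + t * (2 - s))
        ≤ Real.exp (-2 * s) * (s - 1) ^ 2 := mul_le_mul_of_nonneg_left hB hpos.le
      _ < Real.exp (-2 * s) * Real.exp (2 * s) := mul_lt_mul_of_pos_left h3 hpos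
      _ = 1 := hexp

end Summit.NavierStokesRegularity.NavierStokesRegularity.Theorems
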